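import Mathlib
import Literature.NumberTheory.EllipticCurves.KuriharaNumber

/-!
# Proof of the first lemma of crux idea `kurihara-fourier-support` (crux `PlecticLegs.TwistSupply`)

Pure finite Fourier analysis: a non-zero mod-`p` Kurihara number forces an order-`p` Dirichlet character
with non-vanishing twisted plus-symbol sum.
-/

noncomputable section

set_option linter.dupNamespace false

open scoped MatrixGroups ModularForm Classical

open CongruenceSubgroup Literature.NumberTheory.EllipticCurves
  Literature.NumberTheory.EllipticCurves.ModularForms

namespace Summit.BirchSwinnertonDyer.BirchSwinnertonDyer.Cruxes.TwistSupply.KuriharaFourierSupport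

section CastSum

variable {p : ℕ} [Fact p.Prime]

/-- Casting a finite sum of `p`-integral rationals into `ZMod p` is additive, and the sum is again
`p`-integral. -/
theorem ratCast_sum_zmod {ι : Type*} (s : Finset ι) (q : ι → ℚ) (hq : ∀ i ∈ s, ¬ p ∣ (q i).den) :
    ((∑ i ∈ s, q i : ℚ) : ZMod p) = ∑ i ∈ s, ((q i : ℚ) : ZMod p) ∧ ¬ p ∣ (∑ i ∈ s, q i).den := by
  classical
  induction s using Finset.induction_on with
  | empty => simp [(Fact.out : p.Prime).one_lt.ne']
  | insert a s ha ih =>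
    have hqa : ¬ p ∣ (q a).den := hq a (Finset.mem_insert_self a s)
    have hs := ih (fun i hi => hq i (Finset.mem_insert_of_mem hi))
    rw [Finset.sum_insert ha, Finset.sum_insert ha]
    have h1 : ((q a).den : ZMod p) ≠ 0 := by
      rwa [Ne, ZMod.natCast_eq_zero_iff]
    have h2 : ((∑ i ∈ s, q i).den : ZMod p) ≠ 0 := by
      rw [Ne, ZMod.natCast_eq_zero_iff]; exact hs.2
    refine ⟨by rw [Rat.cast_add_of_ne_zero h1 h2, hs.1], fun hdvd => ?_⟩
    have := (Nat.dvd_trans hdvd (Rat.add_den_dvd (q a) (∑ i ∈ s, q i)))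
    rcases (Fact.out : p.Prime).dvd_mul.mp this with h | h
    · exact hqa h
    · exact hs.2 h

end CastSum

section Fourier

variable {V : Type*} [AddCommGroup V] [Fintype V] [DecidableEq V]

/-- Finite Fourier non-degeneracy: a complex function on a finite abelian group orthogonal to every
additive character vanishes. -/
theorem eq_zero_of_forall_addChar_sum_eq_zero (Φ : V → ℂ)
    (h : ∀ ψ : AddChar V ℂ, ∑ v, ψ v * Φ v = 0) : Φ = 0 := by
  classical
  -- the linear functional `g ↦ ∑ g v Φ v` kills the basis of characters, hence everything
  let L : (V → ℂ) →ₗ[ℂ] ℂ :=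
    { toFun := fun g => ∑ v, g v * Φ v
      map_add' := by intro g g'; simp [add_mul, Finset.sum_add_distrib]
      map_smul' := by intro c g; simp [Finset.mul_sum, mul_assoc] }
  have hL : L = 0 := by
    apply (AddChar.complexBasis V).ext
    intro ψ
    simp only [LinearMap.zero_apply]
    have := h ψ
    simpa [L, AddChar.coe_complexBasis] using this
  funext v₀
  have := LinearMap.congr_fun hL (Pi.single v₀ 1)
  simpa [L, Pi.single_apply, Finset.sum_ite_eq', Finset.mem_univ] using this

end Fourier

section Main

variable {N : ℕ} (f : CuspForm (Gamma0 N) 2) (p n : ℕ) [Fact p.Prime] [NeZero n]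

/-- The vector of discrete logarithms of `a ∈ (ℤ/n)ˣ` at the primes dividing `n`. -/
def logVec (ψ : (ℓ : ℕ) → (ZMod ℓ)ˣ →* Multiplicative (ZMod p)) (a : (ZMod n)ˣ) :
    n.primeFactors → ZMod p :=
  fun ℓ => Multiplicative.toAdd (ψ ℓ.1 (ZMod.unitsMap (Nat.dvd_of_mem_primeFactors ℓ.2) a))

omit [NeZero n] in
theorem logVec_mul (ψ : (ℓ : ℕ) → (ZMod ℓ)ˣ →* Multiplicative (ZMod p)) (a b : (ZMod n)ˣ) :
    logVec p n ψ (a * b) = logVec p n ψ a + logVec p n ψ b := by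
  funext ℓ; simp [logVec, map_mul, toAdd_mul]

omit [NeZero n] in
theorem logVec_one (ψ : (ℓ : ℕ) → (ZMod ℓ)ˣ →* Multiplicative (ZMod p)) :
    logVec p n ψ 1 = 0 := by
  funext ℓ; simp [logVec]

/-- **First lemma.** See `Sketch.lean` / the idea card. -/
theorem firstLemma_orderP_support_of_kuriharaNumber
    (ψ : (ℓ : ℕ) → (ZMod ℓ)ˣ →* Multiplicative (ZMod p))
    (hint : ∀ a : (ZMod n)ˣ, ¬ p ∣ (ratPlusSymbol f (((a : ZMod n).val : ℚ) / n)).den)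
    (h0 : ∑ a : (ZMod n)ˣ, ratPlusSymbol f (((a : ZMod n).val : ℚ) / n) = 0)
    (hδ : kuriharaNumber f p n ψ ≠ 0) :
    ∃ χ : DirichletCharacter ℂ n, χ ^ p = 1 ∧ χ ≠ 1 ∧
      ∑ a : (ZMod n)ˣ, χ (a : ZMod n) * ((ratPlusSymbol f (((a : ZMod n).val : ℚ) / n) : ℚ) : ℂ) ≠ 0 := by
  classical
  -- notation
  set φ : (ZMod n)ˣ → ℚ := fun a => ratPlusSymbol f (((a : ZMod n).val : ℚ) / n) with hφ
  set lv : (ZMod n)ˣ → (n.primeFactors → ZMod p) := logVec p n ψ with hlv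
  -- the pushforward
  set Φ : (n.primeFactors → ZMod p) → ℚ := fun v => ∑ a ∈ Finset.univ.filter (fun a => lv a = v), φ a
    with hΦ
  -- Step 1: Φ is not identically zero
  have hΦne : ∃ v, Φ v ≠ 0 := by
    by_contra hall
    push Not at hall
    apply hδ
    rw [kuriharaNumber_eq_sum_ratCast]
    -- rewrite the product over `attach` as a function of `lv a`
    have hprod : ∀ a : (ZMod n)ˣ,
        (∏ ℓ ∈ n.primeFactors.attach, Multiplicative.toAdd
          (ψ ℓ.1 (ZMod.unitsMap (Nat.dvd_of_mem_primeFactors ℓ.2) a))) = ∏ ℓ, lv a ℓ := by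
      intro a
      rw [Finset.attach_eq_univ]
      rfl
    simp_rw [hprod]
    rw [← Finset.sum_fiberwise Finset.univ lv]
    apply Finset.sum_eq_zero
    intro v _
    have hfib : ∀ a ∈ Finset.univ.filter (fun a => lv a = v),
        ((φ a : ℚ) : ZMod p) * ∏ ℓ, lv a ℓ = ((φ a : ℚ) : ZMod p) * ∏ ℓ, v ℓ := by
      intro a ha
      rw [Finset.mem_filter] at ha
      rw [ha.2]
    rw [Finset.sum_congr rfl hfib, ← Finset.sum_mul,
      ← (ratCast_sum_zmod _ φ (fun a _ => hint a)).1]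
    have : (∑ i ∈ Finset.univ.filter (fun a => lv a = v), φ i) = Φ v := rfl
    rw [this, hall v, Rat.cast_zero, zero_mul]
  -- Step 2: a character of V not orthogonal to Φ
  have hχV : ∃ ψV : AddChar (n.primeFactors → ZMod p) ℂ, ∑ v, ψV v * (Φ v : ℂ) ≠ 0 := by
    by_contra hall
    push Not at hall
    have hz := eq_zero_of_forall_addChar_sum_eq_zero (fun v => (Φ v : ℂ)) hall
    obtain ⟨v, hv⟩ := hΦne
    have := congr_fun hz v
    simp only [Pi.zero_apply, Rat.cast_eq_zero] at this
    exact hv this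
  obtain ⟨ψV, hψV⟩ := hχV
  -- Step 3: the Dirichlet character `a ↦ ψV (lv a)`
  have hinv : ∀ v, ψV v * ψV (-v) = 1 := fun v => by
    rw [← AddChar.map_add_eq_mul, add_neg_cancel, AddChar.map_zero_eq_one]
  let u : (ZMod n)ˣ →* ℂˣ :=
    { toFun := fun a => ⟨ψV (lv a), ψV (-(lv a)), hinv _, by rw [mul_comm]; exact hinv _⟩
      map_one' := by
        apply Units.ext
        show ψV (lv 1) = 1
        rw [show lv 1 = 0 from logVec_one p n ψ, AddChar.map_zero_eq_one]
      map_mul' := by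
        intro a b
        apply Units.ext
        show ψV (lv (a * b)) = ψV (lv a) * ψV (lv b)
        rw [show lv (a * b) = lv a + lv b from logVec_mul p n ψ a b, AddChar.map_add_eq_mul] }
  have hu : ∀ a : (ZMod n)ˣ, (u a : ℂ) = ψV (lv a) := fun a => rfl
  let χ : DirichletCharacter ℂ n := MulChar.ofUnitHom u
  have hχ : ∀ a : (ZMod n)ˣ, χ (a : ZMod n) = ψV (lv a) := fun a => by
    rw [show χ (a : ZMod n) = (u a : ℂ) from MulChar.ofUnitHom_coe u a, hu]
  -- Step 4: the twisted sum equals the Fourier coefficient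
  have hsum : ∑ a : (ZMod n)ˣ, χ (a : ZMod n) * ((φ a : ℚ) : ℂ) = ∑ v, ψV v * (Φ v : ℂ) := by
    simp_rw [hχ]
    rw [← Finset.sum_fiberwise Finset.univ lv]
    apply Finset.sum_congr rfl
    intro v _
    have hfib : ∀ a ∈ Finset.univ.filter (fun a => lv a = v),
        ψV (lv a) * ((φ a : ℚ) : ℂ) = ψV v * ((φ a : ℚ) : ℂ) := by
      intro a ha
      rw [Finset.mem_filter] at ha
      rw [ha.2]
    rw [Finset.sum_congr rfl hfib, ← Finset.mul_sum, Rat.cast_sum]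
  refine ⟨χ, ?_, ?_, ?_⟩
  · -- χ ^ p = 1
    apply MulChar.ext
    intro a
    rw [MulChar.pow_apply_coe, MulChar.one_apply_coe, hχ, ← AddChar.map_nsmul_eq_pow]
    have : p • lv a = 0 := by
      funext ℓ
      simp [nsmul_eq_mul]
    rw [this, AddChar.map_zero_eq_one]
  · -- χ ≠ 1
    intro h1
    apply hψV
    rw [← hsum]
    have : ∀ a : (ZMod n)ˣ, χ (a : ZMod n) * ((φ a : ℚ) : ℂ) = ((φ a : ℚ) : ℂ) := by
      intro a; rw [h1, MulChar.one_apply_coe, one_mul]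
    rw [Finset.sum_congr rfl (fun a _ => this a), ← Rat.cast_sum, h0, Rat.cast_zero]
  · rw [hsum]; exact hψV

end Main

end Summit.BirchSwinnertonDyer.BirchSwinnertonDyer.Cruxes.TwistSupply.KuriharaFourierSupport

end
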